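/-
Copyright (c) 2026 the pub-hodgecm-mathlib formalisation cell (harness21).  Prover seat hodgecm-mathlib-K2Liu-p01 (g11), Track B «K2-LIT» ∕ hLiu418 #184♮, socket #41,
KIND 1 a♮ — (β) THE LOC-FACE PRODUCER AT THE RECORD (K1a desk K2E5-p16 (g8) NAME 2026-09-05T01:47:26Z): the place letters `Gn hGn hW` of ★ p864235
`exists_kindOne_singularTerm_of_record₂` for the (KW-fac) reading of the local factors, by `choose` over ★ p863501 `exists_localFace_kindOneSingular` per place.
THEOREMS ONLY (no `def`, no `instance`, no notation, no named-fact hypothesis, no `sorry`).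
-/
import Summits.HodgeConjecture.HodgeConjecture.Theorems.K2LiuKindOneSingularLocalFace           -- ★ p863501 (LH4-p07): `exists_localFace_kindOneSingular`
import Summits.HodgeConjecture.HodgeConjecture.Theorems.K2LiuKindOneSingularTermOfRecordEdTwo  -- ★ p864235 (this seat): the consumer's binder bytes (`Gn hGn hW`), the K2Lit record frame
import Literature.NumberTheory.Automorphic.AdicCompletionResidueCard                            -- ★ `residueFieldCard_adicCompletion_eq` (`residueFieldCard (L⁺_v) = q_v`)
import HarnessLib

/-!
# Crux `HLiu418`, socket #41, KIND 1 a♮ — (β) `K2LiuKindOneSingularLocalFaceOfRecord`: THE LOC-FACE LETTERS `Gn hGn hW` AT THE RECORD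

Cell `hodgecm-mathlib`, crux item hLiu418 = `stmt-HodgeConjecture-24832` (helper lane `--supports … --as helper`, count-neutral), route of record
`HCCMUnconditional`; squad K2 ∕ K2Liu, road `K2_Liu`, socket #41 `sig_K2LiuSiegelEisensteinContinuation`, KIND 1, block K1-a♮; K1a desk K2E5-p16 (g8).

THE SLOT.  ★ p864235 `K2LiuKindOneSingularTermOfRecordEdTwo.exists_kindOne_singularTerm_of_record₂` (the K1-a♮ block of record at `n = 2`) keeps BY VALUE the «LOC-FACE» letters
`Gn hGn hW`: for every rank-one index `S`, every `h ∈ H(𝔸)`, every pure tensor `i` and every place `v` of the local index set `T S h`, the raw local factor of ★ p863805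
`W S i v s h = ∫_{N_Δ(L⁺_v)} conj ψ_{σc(S)E₁₁}(ι_v y) · Fv_{i,v}(s)((w_Δ)_v · y · (gc S·h)_v) dνv(y)` (the (KW-fac) reading `Fv_{i,v}(s) = H_𝒦(ι_v ·)^{2(s−s₀)}·b_{i,v}` above the bad set
`S₀`, `= Λ_{s,v}` off `S₀`) must agree on `{1 < re s}` with a function `Gn S i v · h` that is `q_v`-rational and regular at EVERY `s₀` of `{0 < re}`.
THE PRODUCER (this file).  Per `(S, i, v)` this is ★ p863501 `exists_localFace_kindOneSingular` at the unitary local character `χ_v`, the corner entry `σ := σc S` (its letter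
`hτ : t₁·Tr(σc S·δ_L) ≠ 0` = ★ p863805 (i), by value), the translate `(gc S·h)_v`, and the local family `G := Fv_{i,v}` — a family of smooth local Siegel sections (★ (KW-fac)'s `hb` ∣ ★
`lambdaLoc_mem_localDegPS`) which must be FLAT on a compact open `K₀(v) ≤ H_v` with the local Iwasawa property `H_v = P_Δ(L⁺_v)·K₀(v)`.  Those two per-place inputs are taken
BY VALUE in ★ p863501's own binder shape (`K₀ hK₀ hIw`, `hflat`), so that either payer docks: off `S₀` (`K₀ := K_{H,v}`, `Λ_{s,v} ≡ 1` on it — ★ `lambdaLoc_mul_localInt`; Iwasawa at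
good places ★ `K2LiuLocalSiegelIwasawa`, and `S₀ ⊇` the non-Iwasawa places in ★ `exists_kindW_factorization`'s construction), above `S₀` (`K₀ := ι_v⁻¹(𝒦.K)`, flat by ★
`heightLoc_mul_of_mem`; its Iwasawa property is the datum-side letter).  The `Gn` are `choose`n; the base of `q_v`-rationality is moved from `residueFieldCard (L⁺_v)` (★ p863501)
to `v.residueCard` (★ p863404 ∕ ★ p864235) by ★ `residueFieldCard_adicCompletion_eq`.
* **`locFace_letters_of_record`** — ⊢ `∃ Gn, hGn ∧ hW` in ★ p864235's residual binder BYTES.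
[KudlaRallis1994, §2], [KudlaSweet1997, §1], [HarrisKudlaSweet1996, §1 (1.15), §6 (6.14)–(6.16)], [Casselman1980, §3 Thm. 3.1], [Tan1999, §3].
HONEST LABEL.  Count-neutral helper, hypothesis-first in the per-place compact ∕ Iwasawa ∕ flatness letters; it closes no socket by itself: `HC_CM` is proved only modulo the
7 printed citations (2 remaining named inputs: hLiu418 = `stmt-HodgeConjecture-24832`, h413 = `stmt-HodgeConjecture-24833`) until rung 0 closes.  RESIDUAL LETTERS, NAMED
(K1a desk K2E5-p16 (g8) RULING 2026-09-05T01:53:37Z on LH4-p07 (g12)'s second-reader word): **(Iw-S₀)** = `hIw` at the places `v ∈ S₀` for a compact on which the reading is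
flat — NOT derivable from `IwasawaDatum.IsStd` (its `C_f` is open but not a product over places); owed at the datum-of-record class ((R1): ★ `K2LiuIwasawaDatumNonempty`'s
product compact + a finite-part transport head) or by the monomial-flat generalisation of the flat chain ((R2), L-sized); off `S₀` the inputs are `K₀ := K_{H,v}` (★
`lambdaLoc_mul_localInt`, ★ `K2LiuLocalSiegelIwasawa` at good places, `S₀ ⊇` non-Iwasawa places once ★ (KW-fac) exports it).  The corner-trace letter `hτ` is ★ p863805
FILE 1 §2 (i) but is NOT re-exported by ★ p863805's head (only the transport (a) is): its payer at the tie is K2Liu-p03 (g8)'s witness-transparent (A)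
`htail_hsplit_witnesses_of_record` (g) (in flight), or ★ `cornerTrace_ne_zero` from `σc S ≠ 0` imaginary.

## References
* [KudlaRallis1994] S. Kudla, S. Rallis, *A regularized Siegel–Weil formula: the first term identity*, Ann. of Math. 140 (1994): §2.
* [KudlaSweet1997] S. Kudla, W. J. Sweet, *Degenerate principal series representations for U(n,n)*, Israel J. Math. 98 (1997): §1.
* [HarrisKudlaSweet1996] M. Harris, S. Kudla, W. J. Sweet, J. AMS 9 (1996): §1 (1.15), §6 (6.14)–(6.16).
* [Casselman1980] W. Casselman, *The unramified principal series of p-adic groups I*, Compositio Math. 40 (1980): §3 Thm. 3.1.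
* [Tan1999] V. Tan, *Poles of Siegel Eisenstein series on U(n,n)*, Canad. J. Math. 51 (1999): §3.
-/

set_option autoImplicit false
-- the mandated namespace repeats the single-problem summit's segment (`HodgeConjecture.HodgeConjecture`)
set_option linter.dupNamespace false

noncomputable section

open scoped Matrix NNReal ENNReal ComplexConjugate
open NumberField IsDedekindDomain MeasureTheory Topology
open Literature.NumberTheory.GaloisRepresentations.IsNonarchimedeanLocalField
open Literature.NumberTheory.Automorphic Literature.NumberTheory.Automorphic.UnitaryGroup Literature.NumberTheory.GaloisRepresentations
open Literature.NumberTheory.GelbartRogawski1991 Literature.NumberTheory.GelbartRogawski1991.GRConstruction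
open Literature.NumberTheory.GelbartRogawski1991.UnitaryDualPair Literature.NumberTheory.GelbartRogawski1991.UnitaryDualPair.LocalSplitting
open Literature.NumberTheory.K2Lit Literature.NumberTheory.K2Lit.SiegelDoubled Literature.NumberTheory.K2Lit.LocalSiegelDoubled
open Summit.HodgeConjecture.HodgeConjecture.Cruxes.HLiu418.K2LiuQRationalDefs
open Summit.HodgeConjecture.HodgeConjecture.Cruxes.HLiu418.K2LiuSiegelUnipotentLocalDefs (unipDeltaLoc)
open Summit.HodgeConjecture.HodgeConjecture.Cruxes.HLiu418.K2LiuSiegelUnipotentFourierDefs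
open Summit.HodgeConjecture.HodgeConjecture.Cruxes.HLiu418.K2LiuSiegelUnipotentCharacters
open Summit.HodgeConjecture.HodgeConjecture.Cruxes.HLiu418.K2LiuKindOneSingularLocalFace (exists_localFace_kindOneSingular)

namespace Summit.HodgeConjecture.HodgeConjecture.Cruxes.HLiu418.K2LiuKindOneSingularLocalFaceOfRecord

variable (L : Type) [Field L] [NumberField L] [IsCMField L] {N M : ℕ} (e : Fin N × Fin M ≃ Fin 2)
  (dV : Fin N → L) (hdV : ∀ i, IsCMField.complexConj L (dV i) = dV i) (hdV0 : ∀ i, dV i ≠ 0)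
  (dW : Fin M → L) (hdW : ∀ i, IsCMField.complexConj L (dW i) = dW i) (hdW0 : ∀ i, dW i ≠ 0)

set_option maxHeartbeats 400000 in -- MEASURED at home (farm cmp-12): 200 000 ✗ (`whnf` time-out on the statement's K2Lit CM binder telescope, as ★ p863501 §3), 400 000 ✓
include hdV0 hdW0 in
/-- **(β) THE LOC-FACE LETTERS AT THE RECORD.**  Doubled CM datum of rank `2` (`hdV0 hdW0`), Haar carriers `νv`, a unitary `χ`, the (KW-fac) reading data (`𝒦 s₀ S₀ hχS₀ b hb`:
`Fv_{j,v}(s) := if v ∈ S₀ then H_𝒦(ι_v ·)^{2(s−s₀)}·b_{j,v} else Λ_{s,v}`), ★ p863805's corner datum BY VALUE (`σc` with its letter `hτ` on rank-one `S`, the translate `gc`, the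
local index sets `T`, the raw local factors `W` with their WITNESS equation `hWeq` = ★ p863805 (b).2 at the reading), and PER PLACE, BY VALUE, a compact open `K₀ v ≤ H_v` with the
local Iwasawa property (`hK₀ hIw`, ★ p863501's binders) on which every `Fv_{j,v}` is FLAT (`hflat`).  THEN `∃ Gn` with ★ p864235's «LOC-FACE» letters VERBATIM: for rank-one `S`,
every `h`, `i`, every `v ∈ T S h`: `s ↦ Gn S i v s h` is `q_v`-rational and regular at every `s₀ ∈ {0 < re}` (`hGn`), and `W S i v s h = Gn S i v s h` on `{1 < re s}` (`hW`).
Proof: per `(S, i, v)` ★ `exists_localFace_kindOneSingular` at `G := Fv_{i,v}` (smooth local Siegel sections: `hb` ∣ ★ `lambdaLoc_mem_localDegPS`), `σ := σc S`, then `choose`,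
evaluate at `(gc S·h)_v`, ★ `residueFieldCard_adicCompletion_eq`, `hWeq`.
[cite: KudlaRallis1994, §2] [cite: KudlaSweet1997, §1] [cite: HarrisKudlaSweet1996, §1 (1.15), §6 (6.14)–(6.16)] [cite: Casselman1980, §3 Thm. 3.1] -/
theorem locFace_letters_of_record [DecidableEq (HeightOneSpectrum (𝓞 (Fp L)))]
    [∀ v : HeightOneSpectrum (𝓞 (Fp L)), MeasurableSpace ↥(unipDeltaLoc L e dV hdV dW hdW v)] [∀ v : HeightOneSpectrum (𝓞 (Fp L)), BorelSpace ↥(unipDeltaLoc L e dV hdV dW hdW v)]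
    (νv : ∀ v : HeightOneSpectrum (𝓞 (Fp L)), Measure ↥(unipDeltaLoc L e dV hdV dW hdW v)) [∀ v, (νv v).IsHaarMeasure]
    {χ : HeckeCharacter L} (hχu : χ.IsUnitary) (𝒦 : IwasawaDatum L e dV hdV dW hdW) (s₀ : ℂ)
    {S₀ : Finset (HeightOneSpectrum (𝓞 (Fp L)))} (hχS₀ : ∀ v, v ∉ S₀ → ∀ w : UnitaryGroup.PlacesOver L v, χ.IsUnramifiedAt w.1) {m : ℕ}
    (b : Fin m → (v : HeightOneSpectrum (𝓞 (Fp L))) → (UnitaryGroup.localPi L (IsCMField.complexConj L) (2 + 2) (hermD L e dV hdV dW hdW) v → ℂ))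
    (hb : ∀ i, ∀ v ∈ S₀, ∀ s : ℂ, (fun u => ((modDelta L e dV hdV dW hdW (𝒦.pPart (locToAdelic L e dV hdV dW hdW v u)) : ℝ) : ℂ) ^ (2 * (s - s₀)) * b i v u) ∈
      localDegPS (Fp L) L (IsCMField.complexConj L) (complexConj_imagUnit L) (imagUnit_ne_zero L) (imagUnit_mul_self L)
        v 2 (gramR_isSymm L e dV hdV dW hdW) (hermD_eq_map_gramD L e dV hdV dW hdW) (fun w => χ.localComponent w.1) s)
    -- ★ p863805's corner datum BY VALUE: the corner entries with their letter (i), the translates, the local index sets, the raw local factors with their witness equation (b).2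
    (σc : skewMatrices ((IsCMField.complexConj L : L ≃ₐ[Fp L] L) : L →+* L) ((gramR L e dV hdV dW hdW).map (algebraMap (Fp L) L)) → L)
    (hτ : ∀ S : skewMatrices ((IsCMField.complexConj L : L ≃ₐ[Fp L] L) : L →+* L) ((gramR L e dV hdV dW hdW).map (algebraMap (Fp L) L)),
      (S : Matrix (Fin 2) (Fin 2) L) ≠ 0 → (S : Matrix (Fin 2) (Fin 2) L).det = 0 → gramR L e dV hdV dW hdW 1 1 * Algebra.trace (Fp L) L (σc S * imagUnit L) ≠ 0)
    (gc : skewMatrices ((IsCMField.complexConj L : L ≃ₐ[Fp L] L) : L →+* L) ((gramR L e dV hdV dW hdW).map (algebraMap (Fp L) L)) → HA L e dV hdV dW hdW)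
    (T : skewMatrices ((IsCMField.complexConj L : L ≃ₐ[Fp L] L) : L →+* L) ((gramR L e dV hdV dW hdW).map (algebraMap (Fp L) L)) → HA L e dV hdV dW hdW →
      Finset (HeightOneSpectrum (𝓞 (Fp L))))
    (W : skewMatrices ((IsCMField.complexConj L : L ≃ₐ[Fp L] L) : L →+* L) ((gramR L e dV hdV dW hdW).map (algebraMap (Fp L) L)) → Fin m →
      HeightOneSpectrum (𝓞 (Fp L)) → ℂ → HA L e dV hdV dW hdW → ℂ)
    (hWeq : ∀ (S : skewMatrices ((IsCMField.complexConj L : L ≃ₐ[Fp L] L) : L →+* L) ((gramR L e dV hdV dW hdW).map (algebraMap (Fp L) L))) (j : Fin m)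
      (v : HeightOneSpectrum (𝓞 (Fp L))) (s : ℂ) (h : HA L e dV hdV dW hdW),
      W S j v s h = ∫ y, conj (unipDeltaChar L e dV hdV dW hdW (Matrix.single 1 1 (σc S))
          (locToAdelic L e dV hdV dW hdW v (y : UnitaryGroup.localPi L (IsCMField.complexConj L) (2 + 2) (hermD L e dV hdV dW hdW) v)) : ℂ) *
        (fun (j : Fin m) (v : HeightOneSpectrum (𝓞 (Fp L))) (s : ℂ) (y : UnitaryGroup.localPi L (IsCMField.complexConj L) (2 + 2) (hermD L e dV hdV dW hdW) v) =>
            if v ∈ S₀ then ((modDelta L e dV hdV dW hdW (𝒦.pPart (locToAdelic L e dV hdV dW hdW v y)) : ℝ) : ℂ) ^ (2 * (s - s₀)) * b j v y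
            else LambdaLoc L e dV hdV dW hdW v χ s y) j v s
          (UnitaryGroup.evalPlace (Fp L) L (IsCMField.complexConj L) (2 + 2) (hermD L e dV hdV dW hdW) v
              (UnitaryGroup.finPart (Fp L) L (IsCMField.complexConj L) (2 + 2) (hermD L e dV hdV dW hdW) (weylDelta L e dV hdV dW hdW)) *
            (y : UnitaryGroup.localPi L (IsCMField.complexConj L) (2 + 2) (hermD L e dV hdV dW hdW) v) *
            UnitaryGroup.evalPlace (Fp L) L (IsCMField.complexConj L) (2 + 2) (hermD L e dV hdV dW hdW) v
              (UnitaryGroup.finPart (Fp L) L (IsCMField.complexConj L) (2 + 2) (hermD L e dV hdV dW hdW) (gc S * h))) ∂(νv v))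
    -- PER PLACE, BY VALUE: a compact open subgroup with the local Iwasawa property (★ p863501's binders) on which every local factor of the reading is FLAT
    (K₀ : ∀ v : HeightOneSpectrum (𝓞 (Fp L)), Subgroup (UnitaryGroup.localPi L (IsCMField.complexConj L) (2 + 2) (hermD L e dV hdV dW hdW) v))
    (hK₀ : ∀ v, IsCompact (K₀ v : Set (UnitaryGroup.localPi L (IsCMField.complexConj L) (2 + 2) (hermD L e dV hdV dW hdW) v)) ∧
      IsOpen (K₀ v : Set (UnitaryGroup.localPi L (IsCMField.complexConj L) (2 + 2) (hermD L e dV hdV dW hdW) v)))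
    (hIw : haveI : Algebra.IsQuadraticExtension (Fp L) L := IsCMField.isQuadraticExtension L
      ∀ (v : HeightOneSpectrum (𝓞 (Fp L))) (g : UnitaryGroup.localPi L (IsCMField.complexConj L) (2 + 2) (hermD L e dV hdV dW hdW) v),
        ∃ p, IsSiegelDelta (Fp L) L (IsCMField.complexConj L) (complexConj_imagUnit L) (imagUnit_ne_zero L) (imagUnit_mul_self L)
          v 2 (gramR_isSymm L e dV hdV dW hdW) (hermD_eq_map_gramD L e dV hdV dW hdW) p ∧ ∃ k ∈ K₀ v, g = p * k)
    (hflat : ∀ (j : Fin m) (v : HeightOneSpectrum (𝓞 (Fp L))) (s s' : ℂ), ∀ k ∈ K₀ v,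
      (fun (j : Fin m) (v : HeightOneSpectrum (𝓞 (Fp L))) (s : ℂ) (y : UnitaryGroup.localPi L (IsCMField.complexConj L) (2 + 2) (hermD L e dV hdV dW hdW) v) =>
          if v ∈ S₀ then ((modDelta L e dV hdV dW hdW (𝒦.pPart (locToAdelic L e dV hdV dW hdW v y)) : ℝ) : ℂ) ^ (2 * (s - s₀)) * b j v y
          else LambdaLoc L e dV hdV dW hdW v χ s y) j v s k =
      (fun (j : Fin m) (v : HeightOneSpectrum (𝓞 (Fp L))) (s : ℂ) (y : UnitaryGroup.localPi L (IsCMField.complexConj L) (2 + 2) (hermD L e dV hdV dW hdW) v) =>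
          if v ∈ S₀ then ((modDelta L e dV hdV dW hdW (𝒦.pPart (locToAdelic L e dV hdV dW hdW v y)) : ℝ) : ℂ) ^ (2 * (s - s₀)) * b j v y
          else LambdaLoc L e dV hdV dW hdW v χ s y) j v s' k) :
    ∃ Gn : skewMatrices ((IsCMField.complexConj L : L ≃ₐ[Fp L] L) : L →+* L) ((gramR L e dV hdV dW hdW).map (algebraMap (Fp L) L)) → Fin m →
        HeightOneSpectrum (𝓞 (Fp L)) → ℂ → HA L e dV hdV dW hdW → ℂ,
      (∀ S : skewMatrices ((IsCMField.complexConj L : L ≃ₐ[Fp L] L) : L →+* L) ((gramR L e dV hdV dW hdW).map (algebraMap (Fp L) L)),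
        (S : Matrix (Fin 2) (Fin 2) L) ≠ 0 → (S : Matrix (Fin 2) (Fin 2) L).det = 0 → ∀ (h : HA L e dV hdV dW hdW) (i : Fin m), ∀ v ∈ T S h,
          ∀ s₀ : ℂ, 0 < s₀.re → IsQRationalRegularAt (v.residueCard) s₀ (fun s => Gn S i v s h)) ∧
      (∀ S : skewMatrices ((IsCMField.complexConj L : L ≃ₐ[Fp L] L) : L →+* L) ((gramR L e dV hdV dW hdW).map (algebraMap (Fp L) L)),
        (S : Matrix (Fin 2) (Fin 2) L) ≠ 0 → (S : Matrix (Fin 2) (Fin 2) L).det = 0 → ∀ (h : HA L e dV hdV dW hdW) (i : Fin m), ∀ v ∈ T S h,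
          ∀ s : ℂ, 1 < s.re → W S i v s h = Gn S i v s h) := by
  haveI : Algebra.IsQuadraticExtension (Fp L) L := IsCMField.isQuadraticExtension L
  -- the local components of the unitary `χ` are unitary
  have hχ1 : ∀ (v : HeightOneSpectrum (𝓞 (Fp L))) (w : UnitaryGroup.PlacesOver L v) (x : (w.1.adicCompletion L)ˣ), ‖((χ.localComponent w.1 x : ℂˣ) : ℂ)‖ = 1 :=
    fun v w x => by
      rw [HeckeCharacter.localComponent_apply]
      exact hχu _
  -- each local factor of the reading is a smooth local Siegel section of weight `(χ_v, s)` (★ (KW-fac)'s `hb` ∣ ★ `lambdaLoc_mem_localDegPS`)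
  have hmem : ∀ (j : Fin m) (v : HeightOneSpectrum (𝓞 (Fp L))) (s : ℂ),
      (fun (j : Fin m) (v : HeightOneSpectrum (𝓞 (Fp L))) (s : ℂ) (y : UnitaryGroup.localPi L (IsCMField.complexConj L) (2 + 2) (hermD L e dV hdV dW hdW) v) =>
          if v ∈ S₀ then ((modDelta L e dV hdV dW hdW (𝒦.pPart (locToAdelic L e dV hdV dW hdW v y)) : ℝ) : ℂ) ^ (2 * (s - s₀)) * b j v y
          else LambdaLoc L e dV hdV dW hdW v χ s y) j v s ∈
      localDegPS (Fp L) L (IsCMField.complexConj L) (complexConj_imagUnit L) (imagUnit_ne_zero L) (imagUnit_mul_self L)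
        v 2 (gramR_isSymm L e dV hdV dW hdW) (hermD_eq_map_gramD L e dV hdV dW hdW) (fun w => χ.localComponent w.1) s := by
    intro j v s
    by_cases hv : v ∈ S₀
    · simp only [hv, if_true]
      exact hb j v hv s
    · simp only [hv, if_false]
      exact lambdaLoc_mem_localDegPS L e dV hdV dW hdW v χ s (hχS₀ v hv)
  -- per `(S, j, v)`: ★ p863501 at the corner entry `σc S` (vacuous off rank one)
  have key : ∀ (S : skewMatrices ((IsCMField.complexConj L : L ≃ₐ[Fp L] L) : L →+* L) ((gramR L e dV hdV dW hdW).map (algebraMap (Fp L) L))) (j : Fin m)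
      (v : HeightOneSpectrum (𝓞 (Fp L))),
      ∃ Gn₀ : ℂ → UnitaryGroup.localPi L (IsCMField.complexConj L) (2 + 2) (hermD L e dV hdV dW hdW) v → ℂ,
        (S : Matrix (Fin 2) (Fin 2) L) ≠ 0 → (S : Matrix (Fin 2) (Fin 2) L).det = 0 →
        (∀ s₁ : ℂ, 0 < s₁.re → ∀ x, IsQRationalRegularAt (residueFieldCard (v.adicCompletion (Fp L))) s₁ (fun s => Gn₀ s x)) ∧
        ∀ s : ℂ, 1 < s.re → ∀ x : UnitaryGroup.localPi L (IsCMField.complexConj L) (2 + 2) (hermD L e dV hdV dW hdW) v,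
          ∫ y : ↥(unipDeltaLoc L e dV hdV dW hdW v), conj ((unipDeltaChar L e dV hdV dW hdW (Matrix.single 1 1 (σc S))
                (locToAdelic L e dV hdV dW hdW v (y : UnitaryGroup.localPi L (IsCMField.complexConj L) (2 + 2) (hermD L e dV hdV dW hdW) v)) : ℂ)) *
              (fun (j : Fin m) (v : HeightOneSpectrum (𝓞 (Fp L))) (s : ℂ) (y : UnitaryGroup.localPi L (IsCMField.complexConj L) (2 + 2) (hermD L e dV hdV dW hdW) v) =>
                  if v ∈ S₀ then ((modDelta L e dV hdV dW hdW (𝒦.pPart (locToAdelic L e dV hdV dW hdW v y)) : ℝ) : ℂ) ^ (2 * (s - s₀)) * b j v y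
                  else LambdaLoc L e dV hdV dW hdW v χ s y) j v s
                (UnitaryGroup.evalPlace (Fp L) L (IsCMField.complexConj L) (2 + 2) (hermD L e dV hdV dW hdW) v
                    (UnitaryGroup.finPart (Fp L) L (IsCMField.complexConj L) (2 + 2) (hermD L e dV hdV dW hdW) (SiegelDoubled.weylDelta L e dV hdV dW hdW)) *
                  (y : UnitaryGroup.localPi L (IsCMField.complexConj L) (2 + 2) (hermD L e dV hdV dW hdW) v) * x) ∂(νv v) = Gn₀ s x := by
    intro S j v
    by_cases hr : (S : Matrix (Fin 2) (Fin 2) L) ≠ 0 ∧ (S : Matrix (Fin 2) (Fin 2) L).det = 0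
    · obtain ⟨Gn₀, h1, h2⟩ := exists_localFace_kindOneSingular L e dV hdV hdV0 dW hdW hdW0 v (νv v) (fun w => χ.localComponent w.1) (hχ1 v)
        (K₀ v) (hK₀ v) (hIw v) _ (fun s => (hmem j v s).1) (fun s => (hmem j v s).2) (hflat j v) (σc S) (hτ S hr.1 hr.2)
      exact ⟨Gn₀, fun _ _ => ⟨h1, h2⟩⟩
    · exact ⟨fun _ _ => 0, fun h0 hd => absurd ⟨h0, hd⟩ hr⟩
  choose Gn₀ hGn₀ using key
  refine ⟨fun S j v s h => Gn₀ S j v s (UnitaryGroup.evalPlace (Fp L) L (IsCMField.complexConj L) (2 + 2) (hermD L e dV hdV dW hdW) v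
      (UnitaryGroup.finPart (Fp L) L (IsCMField.complexConj L) (2 + 2) (hermD L e dV hdV dW hdW) (gc S * h))), fun S hS0 hSd h i v _ s₁ hs₁ => ?_,
    fun S hS0 hSd h i v _ s hs => ?_⟩
  · -- `hGn`: ★ p863501's regularity, base `residueFieldCard (L⁺_v) = q_v`
    have h1 := (hGn₀ S i v hS0 hSd).1 s₁ hs₁ (UnitaryGroup.evalPlace (Fp L) L (IsCMField.complexConj L) (2 + 2) (hermD L e dV hdV dW hdW) v
      (UnitaryGroup.finPart (Fp L) L (IsCMField.complexConj L) (2 + 2) (hermD L e dV hdV dW hdW) (gc S * h)))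
    rwa [residueFieldCard_adicCompletion_eq (Fp L) v] at h1
  · -- `hW`: the witness equation, then ★ p863501's integral identity at the translate `(gc S·h)_v`
    rw [hWeq]
    exact (hGn₀ S i v hS0 hSd).2 s hs _

end Summit.HodgeConjecture.HodgeConjecture.Cruxes.HLiu418.K2LiuKindOneSingularLocalFaceOfRecord

end
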